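import Mathlib
import Literature.Analysis.FluidPDE.AxisymmetricEuler
import Literature.Analysis.FluidPDE.SwirlTransportProofs
import Literature.Analysis.FluidPDE.AxisymmetricVorticityTransport
import HarnessLib

/-!
# T23, part 1 — rotation calculus and the Lie algebra of the conjugation orbit `θ ↦ R_θ h R_{−θ}`
  (route `DssFarFieldSlaving`, crux `BlowupTypeIDssProfile`, stmt-NavierStokesRegularity-0155 — SUPPORT;
  cell pub-ns-dss; statements and proofs: theory seat g3, `HOME/theory/TiltedIsotropyEmptyTree.lean`
  sha256[16] 9336f5e07602b3c1; the typer split that file for the 400-line cap, inlined its private helper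
  definitions and removed the local notation — nothing else)

HONEST FRAMING. Finite-dimensional calculus on `ℝ³` only; no Navier–Stokes content, no regularity or
blow-up claim, no number. Part 2 (`…Theorems.DssFarFieldSlavingBlowupTypeIDssProfileTiltedIsotropy`)
uses these lemmas for T23 (a non-commuting co-rotating isotropy empties the rotated-DSS cell).
CONTENTS: `hasDerivAt_rotZ_comp` / `hasDerivAt_rotZ_neg_comp` (`d/dθ [R_{±θ} v(θ)]`);
`isAxisymmetric_of_fderiv_rotGen` (`Du(z)[Jz] = J u(z)` everywhere ⇒ `u` axisymmetric);
`fderiv_conjOrbit` (isotropy ⊇ `{R_θ h R_{−θ}}` ⇒ `J − R_θ (hJh⁻¹) R_{−θ}` is an infinitesimal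
symmetry — the infinitesimal form `Ad_h ξ − ξ ∈ Lie Σ_x` of Golubitsky–Stewart 2002 Ch. 6 Lemma 6.3);
`conj_rotGen_add_pi` (`P z + R_π P R_{−π} z = 2c·Jz`, `P = hJh⁻¹`, `c = ⟪P e₀, e₁⟫`);
`commute_rotZ_of_coeff_eq_one` (`c = 1` ⇒ `h` commutes with every `R_φ`; this dichotomy replaces the
closed-subgroup classification of `O(3)`, GSS II Ch. XIII — context only); witnesses of non-commutation
`exists_not_commute_of_reversing`, `exists_not_commute_of_tilted`.
[cite: GolubitskyStewart2002, Ch. 6 Lemma 6.3, Thm 6.4, Ex. 6.6]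
[cite: GolubitskyStewartSchaeffer1988, Ch. XIII Thm 6.1 and Thm 9.2 (context only)]
[cite: KochNadirashviliSereginSverak2009, §1 before (1.5) (rotations about the axis)]
-/

noncomputable section

set_option linter.dupNamespace false

namespace Summit.NavierStokesRegularity.NavierStokesRegularity.Theorems.TiltedIsotropy

open Set Function WithLp
open Literature.Analysis.FluidPDE
open scoped Topology RealInnerProductSpace

/-! ### Coordinates on `ℝ³` -/

/-- Extensionality on `ℝ³` by the three coordinates. -/
theorem ext3 {u v : (EuclideanSpace ℝ (Fin 3))} (h0 : u 0 = v 0) (h1 : u 1 = v 1) (h2 : u 2 = v 2) : u = v := by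
  ext i
  fin_cases i
  exacts [h0, h1, h2]

/-- The inner product on `ℝ³` in coordinates. -/
private theorem inner_fin3 (u v : (EuclideanSpace ℝ (Fin 3))) : ⟪u, v⟫ = u 0 * v 0 + u 1 * v 1 + u 2 * v 2 := by
  simp only [PiLp.inner_apply, RCLike.inner_apply, conj_trivial, Fin.sum_univ_three]
  ring

/-- The `i`-th coordinate of `h v` is `⟪v, h⁻¹ eᵢ⟫` for a linear isometry `h`. -/
private theorem lie_apply_coord (h : (EuclideanSpace ℝ (Fin 3)) ≃ₗᵢ[ℝ] (EuclideanSpace ℝ (Fin 3))) (v : (EuclideanSpace ℝ (Fin 3))) (i : Fin 3) :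
    h v i = ⟪v, h.symm (EuclideanSpace.single i (1 : ℝ))⟫ := by
  rw [← h.inner_map_map v, h.apply_symm_apply, EuclideanSpace.inner_single_right]
  simp

/-- `h⁻¹ z = Σ zᵢ h⁻¹ eᵢ`. -/
private theorem lie_symm_expand (h : (EuclideanSpace ℝ (Fin 3)) ≃ₗᵢ[ℝ] (EuclideanSpace ℝ (Fin 3))) (z : (EuclideanSpace ℝ (Fin 3))) :
    h.symm z = z 0 • h.symm (EuclideanSpace.single 0 (1 : ℝ)) +
      z 1 • h.symm (EuclideanSpace.single 1 (1 : ℝ)) + z 2 • h.symm (EuclideanSpace.single 2 (1 : ℝ)) := by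
  conv_lhs => rw [eq_sum_smul_single z]
  simp only [Fin.sum_univ_three, map_add, LinearIsometryEquiv.map_smul]

/-- First coordinate of the frame vector `(⟪v,a⟫, ⟪v,b⟫, ⟪v,w⟫)`. -/
@[simp] private theorem frame_apply_zero (a b w v : (EuclideanSpace ℝ (Fin 3))) :
    (toLp 2 ![⟪v, a⟫, ⟪v, b⟫, ⟪v, w⟫] : (EuclideanSpace ℝ (Fin 3))) 0 = ⟪v, a⟫ := rfl
/-- Second frame coordinate. -/
@[simp] private theorem frame_apply_one (a b w v : (EuclideanSpace ℝ (Fin 3))) :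
    (toLp 2 ![⟪v, a⟫, ⟪v, b⟫, ⟪v, w⟫] : (EuclideanSpace ℝ (Fin 3))) 1 = ⟪v, b⟫ := rfl
/-- Third frame coordinate. -/
@[simp] private theorem frame_apply_two (a b w v : (EuclideanSpace ℝ (Fin 3))) :
    (toLp 2 ![⟪v, a⟫, ⟪v, b⟫, ⟪v, w⟫] : (EuclideanSpace ℝ (Fin 3))) 2 = ⟪v, w⟫ := rfl

/-- A linear isometry in the coordinates of the frame `(a, b, w) = h⁻¹(e₀, e₁, e₂)`:
`h v = (⟪v,a⟫, ⟪v,b⟫, ⟪v,w⟫)`. -/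
private theorem apply_eq_toFrame (h : (EuclideanSpace ℝ (Fin 3)) ≃ₗᵢ[ℝ] (EuclideanSpace ℝ (Fin 3))) (v : (EuclideanSpace ℝ (Fin 3))) :
    h v = (toLp 2 ![⟪v, h.symm (EuclideanSpace.single 0 (1 : ℝ))⟫,
      ⟪v, h.symm (EuclideanSpace.single 1 (1 : ℝ))⟫, ⟪v, h.symm (EuclideanSpace.single 2 (1 : ℝ))⟫] : (EuclideanSpace ℝ (Fin 3))) :=
  ext3 (lie_apply_coord h v 0) (lie_apply_coord h v 1) (lie_apply_coord h v 2)

/-- … and its inverse `h⁻¹ z = z₀ a + z₁ b + z₂ w`. -/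
private theorem symm_eq_ofFrame (h : (EuclideanSpace ℝ (Fin 3)) ≃ₗᵢ[ℝ] (EuclideanSpace ℝ (Fin 3))) (z : (EuclideanSpace ℝ (Fin 3))) :
    h.symm z = z 0 • h.symm (EuclideanSpace.single 0 (1 : ℝ)) +
      z 1 • h.symm (EuclideanSpace.single 1 (1 : ℝ)) + z 2 • h.symm (EuclideanSpace.single 2 (1 : ℝ)) :=
  lie_symm_expand h z

/-- `rotZ θ (−y) = −rotZ θ y`. -/
theorem rotZ_neg' (θ : ℝ) (y : (EuclideanSpace ℝ (Fin 3))) : rotZ θ (-y) = -rotZ θ y := by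
  rw [← rotZL_apply, map_neg, rotZL_apply]

/-- `rotZ θ 0 = 0` (a private copy; the tree has `SymmetricScarExists.Negative.rotZ_zero_vec'` in an
unrelated heavy module). -/
@[simp] private theorem rotZ_zero_vec (θ : ℝ) : rotZ θ (0 : (EuclideanSpace ℝ (Fin 3))) = 0 := by
  rw [← rotZL_apply, map_zero]

/-- `J` commutes with the rotations about its axis. -/
private theorem rotZ_rotGen (θ : ℝ) (v : (EuclideanSpace ℝ (Fin 3))) : rotZ θ (rotGen v) = rotGen (rotZ θ v) := by
  ext i
  fin_cases i <;> simp [rotGen, rotZ] <;> ring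

/-! ### Rotation calculus: the derivative of a rotating vector -/

/-- The horizontal projection is `−J²`: `−J(J v) = (v₀, v₁, 0)`. -/
@[simp] private theorem negJJ_apply (v : (EuclideanSpace ℝ (Fin 3))) :
    (-(rotGenL.comp rotGenL)) v = (toLp 2 ![v 0, v 1, 0] : (EuclideanSpace ℝ (Fin 3))) := by
  ext i; fin_cases i <;> simp [rotGen]

/-- The axial projection is `1 + J²`: `v + J(J v) = (0, 0, v₂)`. -/
@[simp] private theorem idJJ_apply (v : (EuclideanSpace ℝ (Fin 3))) :
    (ContinuousLinearMap.id ℝ (EuclideanSpace ℝ (Fin 3)) + rotGenL.comp rotGenL) v = (toLp 2 ![0, 0, v 2] : (EuclideanSpace ℝ (Fin 3))) := by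
  ext i; fin_cases i <;> simp [rotGen]

/-- `R_θ x = cos θ (−J²x) + sin θ Jx + (1 + J²)x`, with continuous linear maps. -/
private theorem rotZ_eq_clm (θ : ℝ) (x : (EuclideanSpace ℝ (Fin 3))) :
    rotZ θ x = Real.cos θ • (-(rotGenL.comp rotGenL)) x + Real.sin θ • rotGenL x +
      (ContinuousLinearMap.id ℝ (EuclideanSpace ℝ (Fin 3)) + rotGenL.comp rotGenL) x := by
  rw [negJJ_apply, idJJ_apply, rotGenL_apply, rotZ_eq_cos_sin]

/-- `d/dθ [R_θ v(θ)] = J R_θ v(θ) + R_θ v'(θ)`. -/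
theorem hasDerivAt_rotZ_comp {v : ℝ → (EuclideanSpace ℝ (Fin 3))} {v' : (EuclideanSpace ℝ (Fin 3))} {θ₀ : ℝ} (hv : HasDerivAt v v' θ₀) :
    HasDerivAt (fun θ => rotZ θ (v θ)) (rotGen (rotZ θ₀ (v θ₀)) + rotZ θ₀ v') θ₀ := by
  have hfun : (fun θ => rotZ θ (v θ)) =
      fun θ => Real.cos θ • (-(rotGenL.comp rotGenL)) (v θ) + Real.sin θ • rotGenL (v θ) +
        (ContinuousLinearMap.id ℝ (EuclideanSpace ℝ (Fin 3)) + rotGenL.comp rotGenL) (v θ) :=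
    funext fun θ => rotZ_eq_clm θ (v θ)
  rw [hfun]
  have h1 : HasDerivAt (fun θ => Real.cos θ • (-(rotGenL.comp rotGenL)) (v θ))
      (Real.cos θ₀ • (-(rotGenL.comp rotGenL)) v' + -Real.sin θ₀ • (-(rotGenL.comp rotGenL)) (v θ₀)) θ₀ :=
    (Real.hasDerivAt_cos θ₀).smul ((-(rotGenL.comp rotGenL)).hasFDerivAt.comp_hasDerivAt θ₀ hv)
  have h2 : HasDerivAt (fun θ => Real.sin θ • rotGenL (v θ))
      (Real.sin θ₀ • rotGenL v' + Real.cos θ₀ • rotGenL (v θ₀)) θ₀ :=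
    (Real.hasDerivAt_sin θ₀).smul (rotGenL.hasFDerivAt.comp_hasDerivAt θ₀ hv)
  have h3 : HasDerivAt (fun θ => (ContinuousLinearMap.id ℝ (EuclideanSpace ℝ (Fin 3)) + rotGenL.comp rotGenL) (v θ))
      ((ContinuousLinearMap.id ℝ (EuclideanSpace ℝ (Fin 3)) + rotGenL.comp rotGenL) v') θ₀ :=
    (ContinuousLinearMap.id ℝ (EuclideanSpace ℝ (Fin 3)) + rotGenL.comp rotGenL).hasFDerivAt.comp_hasDerivAt θ₀ hv
  have H : HasDerivAt (fun θ => Real.cos θ • (-(rotGenL.comp rotGenL)) (v θ) + Real.sin θ • rotGenL (v θ) +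
      (ContinuousLinearMap.id ℝ (EuclideanSpace ℝ (Fin 3)) + rotGenL.comp rotGenL) (v θ))
      (Real.cos θ₀ • (-(rotGenL.comp rotGenL)) v' + -Real.sin θ₀ • (-(rotGenL.comp rotGenL)) (v θ₀) +
        (Real.sin θ₀ • rotGenL v' + Real.cos θ₀ • rotGenL (v θ₀)) +
        (ContinuousLinearMap.id ℝ (EuclideanSpace ℝ (Fin 3)) + rotGenL.comp rotGenL) v') θ₀ :=
    (h1.add h2).add h3
  refine H.congr_deriv ?_
  ext i
  fin_cases i <;> simp [rotGen, rotZ] <;> ring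

/-- `d/dθ [R_{−θ} v(θ)] = −J R_{−θ} v(θ) + R_{−θ} v'(θ)`. -/
theorem hasDerivAt_rotZ_neg_comp {v : ℝ → (EuclideanSpace ℝ (Fin 3))} {v' : (EuclideanSpace ℝ (Fin 3))} {θ₀ : ℝ} (hv : HasDerivAt v v' θ₀) :
    HasDerivAt (fun θ => rotZ (-θ) (v θ)) (-rotGen (rotZ (-θ₀) (v θ₀)) + rotZ (-θ₀) v') θ₀ := by
  have hfun : (fun θ => rotZ (-θ) (v θ)) =
      fun θ => Real.cos θ • (-(rotGenL.comp rotGenL)) (v θ) + (-Real.sin θ) • rotGenL (v θ) +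
        (ContinuousLinearMap.id ℝ (EuclideanSpace ℝ (Fin 3)) + rotGenL.comp rotGenL) (v θ) := by
    funext θ
    rw [rotZ_eq_clm, Real.cos_neg, Real.sin_neg]
  rw [hfun]
  have h1 : HasDerivAt (fun θ => Real.cos θ • (-(rotGenL.comp rotGenL)) (v θ))
      (Real.cos θ₀ • (-(rotGenL.comp rotGenL)) v' + -Real.sin θ₀ • (-(rotGenL.comp rotGenL)) (v θ₀)) θ₀ :=
    (Real.hasDerivAt_cos θ₀).smul ((-(rotGenL.comp rotGenL)).hasFDerivAt.comp_hasDerivAt θ₀ hv)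
  have h2 : HasDerivAt (fun θ => (-Real.sin θ) • rotGenL (v θ))
      ((-Real.sin θ₀) • rotGenL v' + (-Real.cos θ₀) • rotGenL (v θ₀)) θ₀ :=
    (Real.hasDerivAt_sin θ₀).neg.smul (rotGenL.hasFDerivAt.comp_hasDerivAt θ₀ hv)
  have h3 : HasDerivAt (fun θ => (ContinuousLinearMap.id ℝ (EuclideanSpace ℝ (Fin 3)) + rotGenL.comp rotGenL) (v θ))
      ((ContinuousLinearMap.id ℝ (EuclideanSpace ℝ (Fin 3)) + rotGenL.comp rotGenL) v') θ₀ :=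
    (ContinuousLinearMap.id ℝ (EuclideanSpace ℝ (Fin 3)) + rotGenL.comp rotGenL).hasFDerivAt.comp_hasDerivAt θ₀ hv
  have H : HasDerivAt
      (fun θ => Real.cos θ • (-(rotGenL.comp rotGenL)) (v θ) + (-Real.sin θ) • rotGenL (v θ) +
        (ContinuousLinearMap.id ℝ (EuclideanSpace ℝ (Fin 3)) + rotGenL.comp rotGenL) (v θ))
      (Real.cos θ₀ • (-(rotGenL.comp rotGenL)) v' + -Real.sin θ₀ • (-(rotGenL.comp rotGenL)) (v θ₀) +
        ((-Real.sin θ₀) • rotGenL v' + (-Real.cos θ₀) • rotGenL (v θ₀)) +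
        (ContinuousLinearMap.id ℝ (EuclideanSpace ℝ (Fin 3)) + rotGenL.comp rotGenL) v') θ₀ :=
    (h1.add h2).add h3
  refine H.congr_deriv ?_
  ext i
  fin_cases i <;> simp [rotGen, rotZ] <;> ring

/-! ### Infinitesimal axisymmetry integrates to axisymmetry -/

/-- A differentiable field with `Du(z)[J z] = J u(z)` everywhere is axisymmetric: the curve
`θ ↦ R_{−θ} u(R_θ y)` has zero derivative. -/
theorem isAxisymmetric_of_fderiv_rotGen {u : (EuclideanSpace ℝ (Fin 3)) → (EuclideanSpace ℝ (Fin 3))} (hu : Differentiable ℝ u)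
    (hinf : ∀ z, fderiv ℝ u z (rotGen z) = rotGen (u z)) : IsAxisymmetric u := by
  intro θ y
  -- the curve `G θ = u (R_θ y)` and `H θ = R_{−θ} (G θ)`
  have hG : ∀ θ₁ : ℝ, HasDerivAt (fun θ => u (rotZ θ y)) (rotGen (u (rotZ θ₁ y))) θ₁ := by
    intro θ₁
    have hrot : HasDerivAt (fun θ => rotZ θ y) (rotGen (rotZ θ₁ y)) θ₁ := by
      simpa using hasDerivAt_rotZ_comp (v := fun _ => y) (hasDerivAt_const θ₁ y)
    have := (hu (rotZ θ₁ y)).hasFDerivAt.comp_hasDerivAt θ₁ hrot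
    rw [hinf] at this
    exact this
  have hH : ∀ θ₁ : ℝ, HasDerivAt (fun θ => rotZ (-θ) (u (rotZ θ y))) 0 θ₁ := by
    intro θ₁
    have := hasDerivAt_rotZ_neg_comp (hG θ₁)
    rw [rotZ_rotGen, neg_add_cancel] at this
    exact this
  have hconst := is_const_of_deriv_eq_zero (f := fun θ => rotZ (-θ) (u (rotZ θ y)))
    (fun θ₁ => (hH θ₁).differentiableAt) (fun θ₁ => (hH θ₁).deriv) θ 0
  simp only [neg_zero, rotZ_zero] at hconst
  -- hconst : rotZ (-θ) (u (rotZ θ y)) = u y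
  have := congrArg (rotZ θ) hconst
  rw [← rotZ_add, add_neg_cancel, rotZ_zero] at this
  exact this

/-! ### Differentiating along the conjugation orbit `θ ↦ R_θ h R_{−θ}` -/

/-- If the isotropy of a differentiable field `W` contains the whole conjugation orbit
`{R_θ h R_{−θ} : θ ∈ ℝ}` of a linear isometry `h`, then `J − R_θ (hJh⁻¹) R_{−θ}` is an
infinitesimal symmetry of `W` for every `θ`. -/
theorem fderiv_conjOrbit {W : (EuclideanSpace ℝ (Fin 3)) → (EuclideanSpace ℝ (Fin 3))} (hW : Differentiable ℝ W) (h : (EuclideanSpace ℝ (Fin 3)) ≃ₗᵢ[ℝ] (EuclideanSpace ℝ (Fin 3)))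
    (hB : ∀ θ y, W (rotZ θ (h (rotZ (-θ) y))) = rotZ θ (h (rotZ (-θ) (W y))))
    (θ₀ : ℝ) (z : (EuclideanSpace ℝ (Fin 3))) :
    fderiv ℝ W z (rotGen z - rotZ θ₀ (h (rotGen (h.symm (rotZ (-θ₀) z))))) =
      rotGen (W z) - rotZ θ₀ (h (rotGen (h.symm (rotZ (-θ₀) (W z))))) := by
  -- the base point `y` with `R_θ₀ h R_{−θ₀} y = z`
  set y : (EuclideanSpace ℝ (Fin 3)) := rotZ θ₀ (h.symm (rotZ (-θ₀) z)) with hy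
  have hy1 : rotZ (-θ₀) y = h.symm (rotZ (-θ₀) z) := by
    rw [hy, ← rotZ_add, neg_add_cancel, rotZ_zero]
  have hyz : rotZ θ₀ (h (rotZ (-θ₀) y)) = z := by
    rw [hy1, LinearIsometryEquiv.apply_symm_apply, ← rotZ_add, add_neg_cancel, rotZ_zero]
  have hWz : rotZ θ₀ (h (rotZ (-θ₀) (W y))) = W z := by rw [← hB θ₀ y, hyz]
  have hWy1 : rotZ (-θ₀) (W y) = h.symm (rotZ (-θ₀) (W z)) := by
    have := congrArg (rotZ (-θ₀)) hWz
    rw [← rotZ_add, neg_add_cancel, rotZ_zero] at this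
    rw [← this, LinearIsometryEquiv.symm_apply_apply]
  -- derivative of the inner curve `θ ↦ h (R_{−θ} w)` for a fixed `w`
  have hinner : ∀ w : (EuclideanSpace ℝ (Fin 3)), HasDerivAt (fun θ => h (rotZ (-θ) w))
      (h (-rotGen (rotZ (-θ₀) w))) θ₀ := by
    intro w
    have h0 : HasDerivAt (fun θ => rotZ (-θ) w) (-rotGen (rotZ (-θ₀) w)) θ₀ := by
      simpa using hasDerivAt_rotZ_neg_comp (v := fun _ => w) (hasDerivAt_const θ₀ w)
    exact (h.toContinuousLinearEquiv : (EuclideanSpace ℝ (Fin 3)) →L[ℝ] (EuclideanSpace ℝ (Fin 3))).hasFDerivAt.comp_hasDerivAt θ₀ h0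
  -- the two curves
  have hγ : HasDerivAt (fun θ => rotZ θ (h (rotZ (-θ) y)))
      (rotGen z + rotZ θ₀ (h (-rotGen (h.symm (rotZ (-θ₀) z))))) θ₀ := by
    have := hasDerivAt_rotZ_comp (hinner y)
    rw [hyz, hy1] at this
    exact this
  have hδ : HasDerivAt (fun θ => rotZ θ (h (rotZ (-θ) (W y))))
      (rotGen (W z) + rotZ θ₀ (h (-rotGen (h.symm (rotZ (-θ₀) (W z)))))) θ₀ := by
    have := hasDerivAt_rotZ_comp (hinner (W y))
    rw [hWz, hWy1] at this
    exact this
  -- chain rule on `W ∘ γ` and uniqueness of the derivative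
  have hWγ : HasDerivAt (fun θ => W (rotZ θ (h (rotZ (-θ) y))))
      (fderiv ℝ W z (rotGen z + rotZ θ₀ (h (-rotGen (h.symm (rotZ (-θ₀) z)))))) θ₀ :=
    (hW z).hasFDerivAt.comp_hasDerivAt_of_eq θ₀ hγ hyz.symm
  have heq : (fun θ => W (rotZ θ (h (rotZ (-θ) y)))) = fun θ => rotZ θ (h (rotZ (-θ) (W y))) :=
    funext fun θ => hB θ y
  rw [heq] at hWγ
  have huniq := hWγ.unique hδ
  rw [map_neg, rotZ_neg', map_neg, rotZ_neg', ← sub_eq_add_neg, ← sub_eq_add_neg] at huniq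
  exact huniq

/-! ### The linear algebra of the orbit: `P + R_π P R_{−π} = 2c J` -/

/-- For `P = h J h⁻¹` (`h` a linear isometry): `P z + R_π P R_{−π} z = 2c · J z` with
`c = ⟪P e₀, e₁⟫`. -/
theorem conj_rotGen_add_pi (h : (EuclideanSpace ℝ (Fin 3)) ≃ₗᵢ[ℝ] (EuclideanSpace ℝ (Fin 3))) (z : (EuclideanSpace ℝ (Fin 3))) :
    h (rotGen (h.symm z)) + rotZ Real.pi (h (rotGen (h.symm (rotZ (-Real.pi) z)))) =
      (2 * h (rotGen (h.symm (EuclideanSpace.single 0 (1 : ℝ)))) 1) • rotGen z := by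
  rw [apply_eq_toFrame h (rotGen (h.symm z)), apply_eq_toFrame h (rotGen (h.symm (rotZ _ z))),
    apply_eq_toFrame h (rotGen (h.symm (EuclideanSpace.single 0 1))), symm_eq_ofFrame h z,
    symm_eq_ofFrame h (rotZ _ z)]
  -- a polynomial identity in the nine coordinates of the frame `(a, b, w) = h⁻¹(e₀, e₁, e₂)`
  set a : (EuclideanSpace ℝ (Fin 3)) := h.symm (EuclideanSpace.single 0 (1 : ℝ))
  set b : (EuclideanSpace ℝ (Fin 3)) := h.symm (EuclideanSpace.single 1 (1 : ℝ))
  set w : (EuclideanSpace ℝ (Fin 3)) := h.symm (EuclideanSpace.single 2 (1 : ℝ))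
  refine ext3 ?_ ?_ ?_ <;>
    simp [inner_fin3, rotGen, Real.cos_pi, Real.sin_pi] <;> ring

/-! ### `c = 1` forces `h` to commute with the rotations about the axis -/

/-- Frame relations: an orthonormal pair `a, b` with `⟪Ja, b⟫ = 1` is horizontal with `b = Ja`, and a
vector `w` orthogonal to both is axial. Elementary real algebra. -/
private theorem frame_relations (a b w : (EuclideanSpace ℝ (Fin 3))) (naa : a 0 * a 0 + a 1 * a 1 + a 2 * a 2 = 1)
    (nbb : b 0 * b 0 + b 1 * b 1 + b 2 * b 2 = 1) (oaw : a 0 * w 0 + a 1 * w 1 + a 2 * w 2 = 0)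
    (obw : b 0 * w 0 + b 1 * w 1 + b 2 * w 2 = 0) (hc : a 0 * b 1 - a 1 * b 0 = 1) :
    b 0 = -a 1 ∧ b 1 = a 0 ∧ a 2 = 0 ∧ b 2 = 0 ∧ w 0 = 0 ∧ w 1 = 0 := by
  -- sum of squares: `(b₀ + a₁)² + (b₁ − a₀)² + a₂² + b₂² = |a|² + |b|² − 2c = 0`
  have key : (b 0 + a 1) ^ 2 + (b 1 - a 0) ^ 2 + a 2 ^ 2 + b 2 ^ 2 = 0 := by
    linear_combination naa + nbb - 2 * hc
  have s1 : (b 0 + a 1) ^ 2 = 0 := by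
    nlinarith [sq_nonneg (b 0 + a 1), sq_nonneg (b 1 - a 0), sq_nonneg (a 2), sq_nonneg (b 2)]
  have s2 : (b 1 - a 0) ^ 2 = 0 := by
    nlinarith [sq_nonneg (b 0 + a 1), sq_nonneg (b 1 - a 0), sq_nonneg (a 2), sq_nonneg (b 2)]
  have s3 : a 2 ^ 2 = 0 := by
    nlinarith [sq_nonneg (b 0 + a 1), sq_nonneg (b 1 - a 0), sq_nonneg (a 2), sq_nonneg (b 2)]
  have s4 : b 2 ^ 2 = 0 := by
    nlinarith [sq_nonneg (b 0 + a 1), sq_nonneg (b 1 - a 0), sq_nonneg (a 2), sq_nonneg (b 2)]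
  have hb0 : b 0 = -a 1 := by have := (pow_eq_zero_iff (n := 2) two_ne_zero).1 s1; linarith
  have hb1 : b 1 = a 0 := by have := (pow_eq_zero_iff (n := 2) two_ne_zero).1 s2; linarith
  have ha2 : a 2 = 0 := (pow_eq_zero_iff (n := 2) two_ne_zero).1 s3
  have hb2 : b 2 = 0 := (pow_eq_zero_iff (n := 2) two_ne_zero).1 s4
  have naa' : a 0 ^ 2 + a 1 ^ 2 = 1 := by rw [ha2] at naa; nlinarith [naa]
  have oaw' : a 0 * w 0 + a 1 * w 1 = 0 := by rw [ha2] at oaw; linarith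
  have obw' : -a 1 * w 0 + a 0 * w 1 = 0 := by rw [hb0, hb1, hb2] at obw; linarith
  have hw0 : w 0 = 0 := by
    linear_combination a 0 * oaw' - a 1 * obw' - w 0 * naa'
  have hw1 : w 1 = 0 := by
    linear_combination a 1 * oaw' + a 0 * obw' - w 1 * naa'
  exact ⟨hb0, hb1, ha2, hb2, hw0, hw1⟩

/-- If `⟪hJh⁻¹ e₀, e₁⟫ = 1` then `h` commutes with every `R_φ` (the frame `h⁻¹(e₀,e₁,e₂)` is then
`(a, Ja, ±e₂)` with `a` horizontal). -/
theorem commute_rotZ_of_coeff_eq_one (h : (EuclideanSpace ℝ (Fin 3)) ≃ₗᵢ[ℝ] (EuclideanSpace ℝ (Fin 3)))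
    (hc : h (rotGen (h.symm (EuclideanSpace.single 0 (1 : ℝ)))) 1 = 1) :
    ∀ φ y, h (rotZ φ y) = rotZ φ (h y) := by
  -- orthonormality of the frame `h⁻¹ (e₀, e₁, e₂)`
  have orth : ∀ i j : Fin 3, ⟪h.symm (EuclideanSpace.single i (1 : ℝ)),
      h.symm (EuclideanSpace.single j (1 : ℝ))⟫ = if i = j then (1 : ℝ) else 0 := by
    intro i j
    rw [h.symm.inner_map_map, EuclideanSpace.inner_single_left]
    by_cases hij : i = j
    · subst hij; simp
    · simp [hij]
  -- name the frame
  obtain ⟨a, ha⟩ : ∃ a : (EuclideanSpace ℝ (Fin 3)), h.symm (EuclideanSpace.single 0 (1 : ℝ)) = a := ⟨_, rfl⟩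
  obtain ⟨b, hb⟩ : ∃ b : (EuclideanSpace ℝ (Fin 3)), h.symm (EuclideanSpace.single 1 (1 : ℝ)) = b := ⟨_, rfl⟩
  obtain ⟨w, hw⟩ : ∃ w : (EuclideanSpace ℝ (Fin 3)), h.symm (EuclideanSpace.single 2 (1 : ℝ)) = w := ⟨_, rfl⟩
  have naa : a 0 * a 0 + a 1 * a 1 + a 2 * a 2 = 1 := by
    have := orth 0 0; rw [ha, inner_fin3] at this; simpa using this
  have nbb : b 0 * b 0 + b 1 * b 1 + b 2 * b 2 = 1 := by
    have := orth 1 1; rw [hb, inner_fin3] at this; simpa using this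
  have oaw : a 0 * w 0 + a 1 * w 1 + a 2 * w 2 = 0 := by
    have := orth 0 2; rw [ha, hw, inner_fin3] at this; simpa using this
  have obw : b 0 * w 0 + b 1 * w 1 + b 2 * w 2 = 0 := by
    have := orth 1 2; rw [hb, hw, inner_fin3] at this; simpa using this
  -- `c = a₀ b₁ − a₁ b₀ = 1`
  have hc' : a 0 * b 1 - a 1 * b 0 = 1 := by
    rw [ha, apply_eq_toFrame h (rotGen a), ha, hb, hw, frame_apply_one, inner_fin3] at hc
    simp only [rotGen_apply_zero, rotGen_apply_one, rotGen_apply_two] at hc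
    linarith
  obtain ⟨hb0, hb1, ha2, hb2, hw0, hw1⟩ := frame_relations a b w naa nbb oaw obw hc'
  -- conclude in the frame
  intro φ y
  rw [apply_eq_toFrame h (rotZ φ y), apply_eq_toFrame h y, ha, hb, hw]
  refine ext3 ?_ ?_ ?_ <;> simp [inner_fin3, hb0, hb1, ha2, hb2, hw0, hw1] <;> ring

/-- Every rotation-REVERSING isometry is non-commuting (so T23 ⊇ T22/T22′). -/
theorem exists_not_commute_of_reversing {g : (EuclideanSpace ℝ (Fin 3)) ≃ₗᵢ[ℝ] (EuclideanSpace ℝ (Fin 3))}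
    (hg : ∀ φ y, g (rotZ φ y) = rotZ (-φ) (g y)) :
    ∃ (φ : ℝ) (y : (EuclideanSpace ℝ (Fin 3))), g (rotZ φ y) ≠ rotZ φ (g y) := by
  refine ⟨Real.pi / 2, g.symm (EuclideanSpace.single 0 (1 : ℝ)), ?_⟩
  rw [hg, LinearIsometryEquiv.apply_symm_apply]
  intro heq
  have := congrArg (fun v : (EuclideanSpace ℝ (Fin 3)) => v 1) heq
  simp at this
  norm_num at this

/-- Every isometry MOVING THE AXIS (`h e₃ ≠ ±e₃`, e.g. a tilted rotation axis) is non-commuting. -/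
theorem exists_not_commute_of_tilted {h : (EuclideanSpace ℝ (Fin 3)) ≃ₗᵢ[ℝ] (EuclideanSpace ℝ (Fin 3))}
    (h3 : h (EuclideanSpace.single 2 (1 : ℝ)) ≠ EuclideanSpace.single 2 (1 : ℝ))
    (h3' : h (EuclideanSpace.single 2 (1 : ℝ)) ≠ -EuclideanSpace.single 2 (1 : ℝ)) :
    ∃ (φ : ℝ) (y : (EuclideanSpace ℝ (Fin 3))), h (rotZ φ y) ≠ rotZ φ (h y) := by
  by_contra hcon
  simp only [not_exists, not_not] at hcon
  -- `v := h e₃` is fixed by every `R_φ` (as `e₃` is), hence axial; being a unit vector it is `±e₃`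
  set v : (EuclideanSpace ℝ (Fin 3)) := h (EuclideanSpace.single 2 (1 : ℝ)) with hv
  have hfix : ∀ φ : ℝ, rotZ φ v = v := by
    intro φ
    have he : rotZ φ (EuclideanSpace.single 2 (1 : ℝ)) = EuclideanSpace.single 2 (1 : ℝ) := by
      ext i; fin_cases i <;> simp
    rw [hv, ← hcon φ, he]
  have hv0 : v 0 = 0 := by
    have := congrArg (fun w : (EuclideanSpace ℝ (Fin 3)) => w 0) (hfix Real.pi)
    simp [Real.cos_pi, Real.sin_pi] at this
    linarith
  have hv1 : v 1 = 0 := by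
    have := congrArg (fun w : (EuclideanSpace ℝ (Fin 3)) => w 1) (hfix Real.pi)
    simp [Real.cos_pi, Real.sin_pi] at this
    linarith
  have hnorm : ‖v‖ = 1 := by
    rw [hv, LinearIsometryEquiv.norm_map, EuclideanSpace.norm_eq]
    simp
  have hsq : v 2 ^ 2 = 1 := by
    have h2 := EuclideanSpace.norm_eq v
    rw [hnorm] at h2
    have h3 : ∑ i : Fin 3, ‖v i‖ ^ 2 = 1 := by
      have := congrArg (fun r : ℝ => r ^ 2) h2
      simp only [one_pow] at this
      rw [Real.sq_sqrt (Finset.sum_nonneg fun i _ => sq_nonneg _)] at this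
      exact this.symm
    simp only [Fin.sum_univ_three, Real.norm_eq_abs, sq_abs, hv0, hv1] at h3
    linarith
  have hprod : (v 2 - 1) * (v 2 + 1) = 0 := by ring_nf; linarith [hsq]
  rcases mul_eq_zero.1 hprod with h2 | h2
  · exact h3 (ext3 (by simp [hv0]) (by simp [hv1]) (by simp; linarith))
  · exact h3' (ext3 (by simp [hv0]) (by simp [hv1]) (by simp; linarith))

end Summit.NavierStokesRegularity.NavierStokesRegularity.Theorems.TiltedIsotropy

end
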